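import Literature.Topology.FourManifolds.GompfSectionCircleFramings
import Mathlib.Algebra.Group.Conj
import HarnessLib

/-!
# The framed Δ₀-move from the framed Δ-move by a change of basis (leaf **F₀** from leaf **F**)

`GompfTheorem43.lean` proves Gompf's Theorem 4.3 (R. Gompf, *More Cappell–Shaneson spheres are
standard*, Algebr. Geom. Topol. 10 (2010)) from atomic named facts, among them the two *framed*
instances of Theorem 2.1 used in its proof:

* **F** `Literature.Topology.FourManifolds.gompf2010_framedTwist` — §4 ¶3: for `A` in standard form,
  `X^σ_A ≅ X^{τ·σ}_{Δᵏ A}` and `X^σ_A ≅ X^{τ·σ}_{A Δᵏ}`;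
* **F₀** `Literature.Topology.FourManifolds.gompf2010_framedTwistZero` — §4 ¶5: for `A` with second
  column `(1, -1, 0)ᵀ`, `X^σ_A ≅ X^{τ·σ}_{Δ₀ᵏ A}` and `X^σ_A ≅ X^{τ·σ}_{A Δ₀ᵏ}`.

Gompf introduces the Δ₀-move with the sentence (§4 ¶5): "Although any change in monodromy arising
from Theorem 2.1 can be realized by left or right multiplication by some `Δᵏ` *after a suitable
change of basis*, it will be convenient to have another example expressed without the basis
change." This file carries out that change of basis on the tree's concrete spheres and **proves
F₀ from F** (`Literature.Topology.FourManifolds.gompf2010_framedTwistZero_of_framedTwist`), using the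
conjugation invariance **Cj** proved in `GompfConjInvariance.lean`:

* `C₀ := (e₂ | e₃ | e₁ - e₂) ∈ SL(3, ℤ)` (`Literature.Topology.FourManifolds.gompfDeltaZeroBasis`)
  satisfies `Δ₀ = C₀ Δ C₀⁻¹` (`Literature.Topology.FourManifolds.gompfDeltaZero_eq_conj`): both are
  the transvection `x ↦ x + f(x) v` with `(v, f) = (e₃ - e₁, e₂*)` resp. `(e₁ - 2e₂, e₃*)`, and `C₀`
  carries the first pair to the second;
* if `A e₂ = e₁ - e₂` then `A' := C₀⁻¹ A C₀` has `A' e₁ = C₀⁻¹ A e₂ = C₀⁻¹ (e₁ - e₂) = e₃`, i.e. `A'`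
  is in standard form (`Literature.Topology.FourManifolds.isGompfStandardForm_conj_gompfDeltaZeroBasis`),
  and `det (A' - 1) = det (A - 1) = 1`;
* `X^γ_A ≅ X^{C₀⁻¹ γ C₀}_{A'}` (Cj) `≅ X^{(C₀⁻¹ γ C₀)·τ}_{Δᵏ A'}` (F) `≅ X^{C₀ ((C₀⁻¹ γ C₀)·τ) C₀⁻¹}_{C₀ Δᵏ A' C₀⁻¹}`
  (Cj) and `C₀ Δᵏ A' C₀⁻¹ = Δ₀ᵏ A`; finally the framing path `C₀ ((C₀⁻¹ γ C₀)·τ_Δ) C₀⁻¹` *is* the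
  path `γ·τ_{Δ₀}` of `SmoothMatrixPath.deltaZeroLeft` on the nose ("linearity is preserved when we
  undo the change of basis", §4 ¶3: `C₀ (t Δᵏ + (1 - t) I) C₀⁻¹ = t Δ₀ᵏ + (1 - t) I`,
  `Literature.Topology.FourManifolds.conj_deltaLeft_conj_along_eq`), and likewise for the column move.

Consequently the leaf set of the assembly of
`Literature.Topology.FourManifolds.nonempty_diffeomorph_sphere_four_of_isCappellShanesonSphereOf`
(Gompf 2010, Examples 3.1(a)) shrinks from {F, F₀, [AK1]} (`GompfSectionCircleFramings.lean`) to
{F, [AK1]} (`Literature.Topology.FourManifolds.nonempty_diffeomorph_sphere_four_of_isCappellShanesonSphereOf_of_framedTwist_AK`),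
and Theorem 4.3 needs only F (`Literature.Topology.FourManifolds.gompf2010_thm43_of_framedTwist`).

## References

* R. E. Gompf, *More Cappell–Shaneson spheres are standard*, Algebr. Geom. Topol. 10 (2010)
  1665–1681, doi:10.2140/agt.2010.10.1665 (arXiv:0908.1914): §3 ¶3 (the matrix `Δ`), §4 ¶3
  ("after a change of basis … linearity is preserved when we undo the change of basis"), §4 ¶5 (the
  matrix `Δ₀`; "can be realized by left or right multiplication by some `Δᵏ` after a suitable change
  of basis"). [GompfAGT2010]
-/

open scoped Manifold ContDiff Topology
open Set Function Matrix

noncomputable section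

namespace Literature.Topology.FourManifolds

universe u v

/-! ### A smooth matrix path is determined by its path -/

namespace SmoothMatrixPath

section Ext

variable {n : Type*} [Fintype n] [DecidableEq n] {M : Matrix n n ℝ}

/-- **A smooth matrix path is determined by its underlying path**: the inverse path is the
pointwise (two-sided, hence unique) inverse. [folklore] -/
theorem ext_toFun {γ₁ γ₂ : SmoothMatrixPath M} (h : ∀ θ, γ₁.toFun θ = γ₂.toFun θ) : γ₁ = γ₂ := by
  have hinv : ∀ θ, γ₁.inv θ = γ₂.inv θ := fun θ ↦
    calc γ₁.inv θ = γ₁.inv θ * (γ₂.toFun θ * γ₂.inv θ) := by rw [γ₂.mul_inv, Matrix.mul_one]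
      _ = γ₁.inv θ * γ₁.toFun θ * γ₂.inv θ := by rw [h θ, Matrix.mul_assoc]
      _ = γ₂.inv θ := by rw [γ₁.inv_mul, Matrix.one_mul]
  rcases γ₁ with ⟨f₁, i₁, _, _, _, _, _, _⟩
  rcases γ₂ with ⟨f₂, i₂, _, _, _, _, _, _⟩
  dsimp only at h hinv
  obtain rfl : f₁ = f₂ := funext h
  obtain rfl : i₁ = i₂ := funext hinv
  rfl

end Ext

/-! ### The paths `τ·σ` of the four moves, pointwise -/

variable {A : Matrix.SpecialLinearGroup (Fin 3) ℤ} (γ : SmoothMatrixPath (slRealMatrix A)) (k : ℤ)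
  (θ : ℝ)

/-- The path of the row move `A ↦ Δᵏ A`, pointwise: `γ` at double speed, then the reparametrised
segment `t Δᵏ + (1 - t) I` applied to `A` on the left. [cite: GompfAGT2010, §4 ¶3 (X^{τ·σ}_B = X^σ_A for B = Δᵏ A or A Δᵏ)] -/
theorem deltaLeft_toFun : (γ.deltaLeft k).toFun θ =
    linearPath (slRealMatrix (gompfDelta ^ k)) (Real.smoothTransition (2 * θ - 1)) *
      γ.toFun (2 * θ) := rfl

/-- The path of the column move `A ↦ A Δᵏ = (A Δᵏ A⁻¹) A`, pointwise. [cite: GompfAGT2010, §4 ¶3 (X^{τ·σ}_B = X^σ_A for B = Δᵏ A or A Δᵏ)] -/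
theorem deltaRight_toFun : (γ.deltaRight k).toFun θ =
    linearPath (slRealMatrix (A * gompfDelta ^ k * A⁻¹)) (Real.smoothTransition (2 * θ - 1)) *
      γ.toFun (2 * θ) := rfl

/-- The path of the row move `A ↦ Δ₀ᵏ A`, pointwise. [cite: GompfAGT2010, §4 ¶5 (X^{τ·σ}_B = X^σ_A for B = Δ₀ᵏ A or A Δ₀ᵏ)] -/
theorem deltaZeroLeft_toFun : (γ.deltaZeroLeft k).toFun θ =
    linearPath (slRealMatrix (gompfDeltaZero ^ k)) (Real.smoothTransition (2 * θ - 1)) *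
      γ.toFun (2 * θ) := rfl

/-- The path of the column move `A ↦ A Δ₀ᵏ = (A Δ₀ᵏ A⁻¹) A`, pointwise. [cite: GompfAGT2010, §4 ¶5 (X^{τ·σ}_B = X^σ_A for B = Δ₀ᵏ A or A Δ₀ᵏ)] -/
theorem deltaZeroRight_toFun : (γ.deltaZeroRight k).toFun θ =
    linearPath (slRealMatrix (A * gompfDeltaZero ^ k * A⁻¹)) (Real.smoothTransition (2 * θ - 1)) *
      γ.toFun (2 * θ) := rfl

end SmoothMatrixPath

/-! ### The change of basis carrying `Δ` to `Δ₀` -/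

section BasisChange

/-- **The change of basis `C₀ = (e₂ | e₃ | e₁ - e₂) ∈ SL(3, ℤ)`** realising Gompf's "suitable change
of basis" between the Δ-move and the Δ₀-move: `Δ₀ = C₀ Δ C₀⁻¹`, and `C₀⁻¹ A C₀` is in standard form
whenever `A e₂ = e₁ - e₂`. [cite: GompfAGT2010, §4 ¶5 (the Δ₀-move is a Δ-move after a suitable change of basis)] -/
def gompfDeltaZeroBasis : Matrix.SpecialLinearGroup (Fin 3) ℤ :=
  ⟨!![0, 0, 1; 1, 0, -1; 0, 1, 0], by decide⟩

/-- The underlying matrix of `C₀`. [folklore] -/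
@[simp] theorem coe_gompfDeltaZeroBasis :
    (gompfDeltaZeroBasis : Matrix (Fin 3) (Fin 3) ℤ) = !![0, 0, 1; 1, 0, -1; 0, 1, 0] := rfl

/-- `C₀⁻¹ = (e₁ + e₃ | e₁ | e₂)`. [folklore] -/
theorem coe_gompfDeltaZeroBasis_inv :
    ((gompfDeltaZeroBasis⁻¹ : Matrix.SpecialLinearGroup (Fin 3) ℤ) : Matrix (Fin 3) (Fin 3) ℤ) =
      !![1, 1, 0; 0, 0, 1; 1, 0, 0] := by
  rw [Matrix.SpecialLinearGroup.coe_inv, coe_gompfDeltaZeroBasis]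
  decide

/-- **`Δ₀ = C₀ Δ C₀⁻¹`**: the Δ₀-move is the Δ-move after the change of basis `C₀`. [cite: GompfAGT2010, §4 ¶5 (the Δ₀-move is a Δ-move after a suitable change of basis)] -/
theorem gompfDeltaZero_eq_conj :
    gompfDeltaZero = gompfDeltaZeroBasis * gompfDelta * gompfDeltaZeroBasis⁻¹ := by
  refine Subtype.ext ?_
  rw [Matrix.SpecialLinearGroup.coe_mul, Matrix.SpecialLinearGroup.coe_mul,
    coe_gompfDeltaZeroBasis_inv, coe_gompfDeltaZeroBasis, coe_gompfDelta, coe_gompfDeltaZero]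
  decide

/-- `Δ₀ᵏ = C₀ Δᵏ C₀⁻¹` for every `k ∈ ℤ`. [cite: GompfAGT2010, §4 ¶5 (the Δ₀-move is a Δ-move after a suitable change of basis)] -/
theorem gompfDeltaZero_zpow_eq_conj (k : ℤ) :
    gompfDeltaZero ^ k = gompfDeltaZeroBasis * gompfDelta ^ k * gompfDeltaZeroBasis⁻¹ := by
  rw [gompfDeltaZero_eq_conj, conj_zpow]

/-- **Undoing the change of basis on the row move**: `C₀ (Δᵏ (C₀⁻¹ A C₀)) C₀⁻¹ = Δ₀ᵏ A`. [cite: GompfAGT2010, §4 ¶5 (the Δ₀-move is a Δ-move after a suitable change of basis)] -/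
theorem conj_gompfDelta_zpow_mul_conj (A : Matrix.SpecialLinearGroup (Fin 3) ℤ) (k : ℤ) :
    gompfDeltaZeroBasis * (gompfDelta ^ k * (gompfDeltaZeroBasis⁻¹ * A * gompfDeltaZeroBasis⁻¹⁻¹)) *
        gompfDeltaZeroBasis⁻¹ = gompfDeltaZero ^ k * A := by
  rw [gompfDeltaZero_zpow_eq_conj]
  group

/-- **Undoing the change of basis on the column move**: `C₀ ((C₀⁻¹ A C₀) Δᵏ) C₀⁻¹ = A Δ₀ᵏ`. [cite: GompfAGT2010, §4 ¶5 (the Δ₀-move is a Δ-move after a suitable change of basis)] -/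
theorem conj_conj_mul_gompfDelta_zpow (A : Matrix.SpecialLinearGroup (Fin 3) ℤ) (k : ℤ) :
    gompfDeltaZeroBasis * (gompfDeltaZeroBasis⁻¹ * A * gompfDeltaZeroBasis⁻¹⁻¹ * gompfDelta ^ k) *
        gompfDeltaZeroBasis⁻¹ = A * gompfDeltaZero ^ k := by
  rw [gompfDeltaZero_zpow_eq_conj]
  group

/-- **`C₀⁻¹ A C₀` is in standard form when `A e₂ = e₁ - e₂`**: its first column is
`C₀⁻¹ A C₀ e₁ = C₀⁻¹ A e₂ = C₀⁻¹ (e₁ - e₂) = e₃` (Gompf, §4 ¶5: "the second basis vector `e₂` and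
`A e₂` span the integer lattice in the plane perpendicular to the third axis", so `(v, w, A v)` with
`v = e₂`, `w = e₃` is a basis as in §3 ¶3). [cite: GompfAGT2010, §4 ¶5 and §3 ¶3 (standard form from a basis (v, w, Av))] -/
theorem isGompfStandardForm_conj_gompfDeltaZeroBasis {A : Matrix.SpecialLinearGroup (Fin 3) ℤ}
    (h01 : (A : Matrix (Fin 3) (Fin 3) ℤ) 0 1 = 1) (h11 : (A : Matrix (Fin 3) (Fin 3) ℤ) 1 1 = -1)
    (h21 : (A : Matrix (Fin 3) (Fin 3) ℤ) 2 1 = 0) :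
    IsGompfStandardForm (gompfDeltaZeroBasis⁻¹ * A * gompfDeltaZeroBasis⁻¹⁻¹) := by
  rw [inv_inv]
  refine ⟨?_, ?_, ?_⟩ <;>
  · simp only [Matrix.SpecialLinearGroup.coe_mul, Matrix.mul_apply, Fin.sum_univ_three,
      coe_gompfDeltaZeroBasis_inv, coe_gompfDeltaZeroBasis]
    simp [h01, h11, h21]

/-- Conjugating the segment `t P + (1 - t) I` by `C` gives the segment of the conjugate
("linearity is preserved when we undo the change of basis"). [cite: GompfAGT2010, §4 ¶3 (linearity is preserved under change of basis)] -/
theorem conj_linearPath_slRealMatrix (C P : Matrix.SpecialLinearGroup (Fin 3) ℤ) (t : ℝ) :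
    slRealMatrix C * linearPath (slRealMatrix P) t * slRealMatrix C⁻¹ =
      linearPath (slRealMatrix (C * P * C⁻¹)) t := by
  rw [slRealMatrix_mul, slRealMatrix_mul, linearPath_conj _ _ _ (slRealMatrix_mul_inv C)]

end BasisChange

/-! ### The framing paths agree on the nose -/

section Paths

variable (A : Matrix.SpecialLinearGroup (Fin 3) ℤ) (k : ℤ) (γ : SmoothMatrixPath (slRealMatrix A))

/-- **Row move: the conjugated framing path is `γ.deltaZeroLeft k`.** Conjugating back by `C₀` the
path "`C₀⁻¹ γ C₀` followed by the segment to `Δᵏ (C₀⁻¹ A C₀)`" gives, pointwise,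
`C₀ (t Δᵏ + (1 - t) I) C₀⁻¹ · γ = (t Δ₀ᵏ + (1 - t) I) · γ`, the path of the Δ₀-row move. [cite: GompfAGT2010, §4 ¶3 and ¶5 (τ the linear path; linearity preserved under change of basis)] -/
theorem conj_deltaLeft_conj_along_eq
    (h : gompfDeltaZeroBasis * (gompfDelta ^ k *
        (gompfDeltaZeroBasis⁻¹ * A * gompfDeltaZeroBasis⁻¹⁻¹)) * gompfDeltaZeroBasis⁻¹ =
      gompfDeltaZero ^ k * A) :
    (((γ.conj gompfDeltaZeroBasis⁻¹).deltaLeft k).conj gompfDeltaZeroBasis).along h =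
      γ.deltaZeroLeft k := by
  refine SmoothMatrixPath.ext_toFun fun θ ↦ ?_
  simp only [SmoothMatrixPath.along_toFun, SmoothMatrixPath.conj_toFun,
    SmoothMatrixPath.deltaLeft_toFun, SmoothMatrixPath.deltaZeroLeft_toFun]
  rw [inv_inv, gompfDeltaZero_zpow_eq_conj, ← conj_linearPath_slRealMatrix gompfDeltaZeroBasis]
  simp only [Matrix.mul_assoc]
  rw [slRealMatrix_mul_inv, Matrix.mul_one]

/-- **Column move: the conjugated framing path is `γ.deltaZeroRight k`** (same computation, with
`C₀ (A' Δᵏ A'⁻¹) C₀⁻¹ = A Δ₀ᵏ A⁻¹` for `A' = C₀⁻¹ A C₀`). [cite: GompfAGT2010, §4 ¶3 and ¶5 (τ the linear path; linearity preserved under change of basis)] -/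
theorem conj_deltaRight_conj_along_eq
    (h : gompfDeltaZeroBasis * (gompfDeltaZeroBasis⁻¹ * A * gompfDeltaZeroBasis⁻¹⁻¹ *
        gompfDelta ^ k) * gompfDeltaZeroBasis⁻¹ = A * gompfDeltaZero ^ k) :
    (((γ.conj gompfDeltaZeroBasis⁻¹).deltaRight k).conj gompfDeltaZeroBasis).along h =
      γ.deltaZeroRight k := by
  refine SmoothMatrixPath.ext_toFun fun θ ↦ ?_
  simp only [SmoothMatrixPath.along_toFun, SmoothMatrixPath.conj_toFun,
    SmoothMatrixPath.deltaRight_toFun, SmoothMatrixPath.deltaZeroRight_toFun]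
  have key : A * gompfDeltaZero ^ k * A⁻¹ = gompfDeltaZeroBasis *
      (gompfDeltaZeroBasis⁻¹ * A * gompfDeltaZeroBasis⁻¹⁻¹ * gompfDelta ^ k *
        (gompfDeltaZeroBasis⁻¹ * A * gompfDeltaZeroBasis⁻¹⁻¹)⁻¹) * gompfDeltaZeroBasis⁻¹ := by
    rw [gompfDeltaZero_zpow_eq_conj]
    group
  rw [key, ← conj_linearPath_slRealMatrix gompfDeltaZeroBasis, inv_inv]
  simp only [Matrix.mul_assoc]
  rw [slRealMatrix_mul_inv, Matrix.mul_one]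

/-- Equal framing paths give the same Gompf sphere. [folklore] -/
theorem nonempty_diffeomorph_gompfSphere_of_eq {B : Matrix.SpecialLinearGroup (Fin 3) ℤ}
    {γ₁ γ₂ : SmoothMatrixPath (slRealMatrix B)} (h : γ₁ = γ₂) :
    Nonempty (gompfSphere B γ₁ ≃ₘ⟮𝓡 4, 𝓡 4⟯ gompfSphere B γ₂) := by
  subst h
  exact ⟨Diffeomorph.refl _ _ _⟩

end Paths

/-! ### F₀ from F -/

section Reduction

/-- **The framed Δ₀-move from the framed Δ-move (F₀ from F).** For `A ∈ SL(3, ℤ)` with second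
column `(1, -1, 0)ᵀ` and `det (A - 1) = 1`, every framing path `γ` and every `k ∈ ℤ`:
`X^γ_A ≅ X^{γ·τ}_{Δ₀ᵏ A}` and `X^γ_A ≅ X^{γ·τ}_{A Δ₀ᵏ}` — by conjugation invariance (**Cj**,
proved in `GompfConjInvariance.lean`) to `A' = C₀⁻¹ A C₀` in standard form, the framed Δ-move **F**
there, conjugation invariance back, and the identity of framing paths
`C₀ ((C₀⁻¹ γ C₀)·τ_Δ) C₀⁻¹ = γ·τ_{Δ₀}` (Gompf 2010, §4 ¶5: the Δ₀-move "can be realized by left or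
right multiplication by some `Δᵏ` after a suitable change of basis"). [cite: GompfAGT2010, §4 ¶5 (X^{τ·σ}_B = X^σ_A for B = Δ₀ᵏ A or A Δ₀ᵏ) and §4 ¶3] -/
theorem gompf2010_framedTwistZero_of_framedTwist (hF : gompf2010_framedTwist) :
    gompf2010_framedTwistZero := by
  intro A h01 h11 h21 hdet γ k
  have hA' := isGompfStandardForm_conj_gompfDeltaZeroBasis h01 h11 h21
  have hdet' : (((gompfDeltaZeroBasis⁻¹ * A * gompfDeltaZeroBasis⁻¹⁻¹ :
      Matrix.SpecialLinearGroup (Fin 3) ℤ) : Matrix (Fin 3) (Fin 3) ℤ) - 1).det = 1 := by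
    rw [det_coe_conj_sub_one]
    exact hdet
  -- Cj: `X^γ_A ≅ X^{C₀⁻¹ γ C₀}_{A'}`
  obtain ⟨e₁⟩ := gompf2010_conj_invariance_holds A gompfDeltaZeroBasis⁻¹ γ
  -- F at `A'`
  have hF' := hF _ hA' hdet' (γ.conj gompfDeltaZeroBasis⁻¹) k
  refine ⟨?_, ?_⟩
  · obtain ⟨e₃⟩ := gompf2010_conj_invariance_holds _ gompfDeltaZeroBasis
      ((γ.conj gompfDeltaZeroBasis⁻¹).deltaLeft k)
    exact nonempty_diffeomorph_trans ⟨e₁.symm⟩ (nonempty_diffeomorph_trans hF'.1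
      (nonempty_diffeomorph_trans ⟨e₃.symm⟩ (nonempty_diffeomorph_trans
        (nonempty_diffeomorph_gompfSphere_along _ (conj_gompfDelta_zpow_mul_conj A k))
        (nonempty_diffeomorph_gompfSphere_of_eq (conj_deltaLeft_conj_along_eq A k γ _)))))
  · obtain ⟨e₃⟩ := gompf2010_conj_invariance_holds _ gompfDeltaZeroBasis
      ((γ.conj gompfDeltaZeroBasis⁻¹).deltaRight k)
    exact nonempty_diffeomorph_trans ⟨e₁.symm⟩ (nonempty_diffeomorph_trans hF'.2
      (nonempty_diffeomorph_trans ⟨e₃.symm⟩ (nonempty_diffeomorph_trans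
        (nonempty_diffeomorph_gompfSphere_along _ (conj_conj_mul_gompfDelta_zpow A k))
        (nonempty_diffeomorph_gompfSphere_of_eq (conj_deltaRight_conj_along_eq A k γ _)))))

/-- **Theorem 4.3 from F alone** (W, Cj, P1, P2 are proved in the tree; F₀ follows from F). [cite: GompfAGT2010, Thm 4.3] -/
theorem gompf2010_thm43_of_framedTwist (hF : gompf2010_framedTwist) : gompf2010_thm43 :=
  gompf2010_thm43_of_framed gompf2010_straightening_invariance_holds gompf2010_conj_invariance_holds
    hF (gompf2010_framedTwistZero_of_framedTwist hF) fundamentalGroup_posDetMatrix_three_holds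
    gompf2010_framingLoop_essential_holds

/-- **The framing-free Theorem 4.3 from F alone**: any two Cappell–Shaneson spheres of `A₀` are
diffeomorphic. [cite: GompfAGT2010, Thm 4.3] -/
theorem gompf2010_akbulutKirby_framings_of_framedTwist (hF : gompf2010_framedTwist) :
    gompf2010_akbulutKirby_framings.{u, v} :=
  gompf2010_akbulutKirby_framings_of_framed gompf2010_straightening_classification_holds
    gompf2010_straightening_classification_holds (gompf2010_thm43_of_framedTwist hF)

end Reduction

end Literature.Topology.FourManifolds

/-! ### The leaf set after F₀: the framed Theorem 2.1 (F) and [AK1] -/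

namespace Literature.Topology.FourManifolds

universe w

variable (X : Type w) [TopologicalSpace X] [T2Space X] [SecondCountableTopology X]
  [ChartedSpace (EuclideanSpace ℝ (Fin 4)) X] [IsManifold (𝓡 4) ∞ X] [CompactSpace X]

/-- **The current leaf set: F and [AK1].**
`nonempty_diffeomorph_sphere_four_of_isCappellShanesonSphereOf X` (Gompf 2010, Examples 3.1(a): every
Cappell–Shaneson sphere of `Aₘ`, either framing, is `S⁴`) from the two remaining named facts — the
framed Theorem 2.1 for the Δ-moves **F** (`gompf2010_framedTwist`) and [AK1]
(`akbulutKirby1979_linearStraightening`) — the Δ₀-instance **F₀** being a consequence of F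
(`gompf2010_framedTwistZero_of_framedTwist`). [cite: GompfAGT2010, Examples 3.1(a)] -/
theorem nonempty_diffeomorph_sphere_four_of_isCappellShanesonSphereOf_of_framedTwist_AK
    (hF : gompf2010_framedTwist) (hAK : akbulutKirby1979_linearStraightening) :
    nonempty_diffeomorph_sphere_four_of_isCappellShanesonSphereOf X :=
  nonempty_diffeomorph_sphere_four_of_isCappellShanesonSphereOf_of_twist_AK X hF
    (gompf2010_framedTwistZero_of_framedTwist hF) hAK

/-! ### Appended 2026-08-16 (librarian, fact-decompose `libsplit-37`): the registered split of
`nonempty_diffeomorph_sphere_four_of_isCappellShanesonSphereOf` -/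

/-- **Registered decomposition of the named fact
`nonempty_diffeomorph_sphere_four_of_isCappellShanesonSphereOf X`** (Gompf 2010, Examples 3.1(a):
every Cappell–Shaneson sphere of `Aₘ`, either framing, is `S⁴`; `CappellShaneson.lean`). Along the
printed proof (Δ-moves of Theorem 2.1, the classification of straightenings §4 ¶2 — PROVED,
`gompf2010_straightening_classification_holds` —, Theorem 4.3 from the framed Theorem 2.1, and the
row moves of §3) every layer is a theorem of the tree except TWO named facts, its children:

* `gompf2010_framedTwist` — the framed Theorem 2.1 (`GompfTheorem43.lean`);
* `akbulutKirby1979_linearStraightening` — [AK1]: the Cappell–Shaneson sphere of `A₀` with the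
  linear straightening is `S⁴` (`GompfFramedSpheres.lean`).

This theorem is `nonempty_diffeomorph_sphere_four_of_isCappellShanesonSphereOf_of_framedTwist_AK`
under the `_holds_of` name by which the split is recorded; nothing new is claimed.
[cite: GompfAGT2010, Examples 3.1(a), Thm 2.1, Thm 4.3] [cite: AkbulutKirby1979, main theorem (Σ ≅ S⁴)] -/
theorem nonempty_diffeomorph_sphere_four_of_isCappellShanesonSphereOf_holds_of
    (hF : gompf2010_framedTwist) (hAK : akbulutKirby1979_linearStraightening) :
    nonempty_diffeomorph_sphere_four_of_isCappellShanesonSphereOf X :=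
  nonempty_diffeomorph_sphere_four_of_isCappellShanesonSphereOf_of_framedTwist_AK X hF hAK

end Literature.Topology.FourManifolds
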